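import Summits.BirchSwinnertonDyer.BirchSwinnertonDyer.Theorems.KatoDescentPotSupersingularKatoFiniteLevelStrictTamagawaLowerBound
import Literature.NumberTheory.EllipticCurves.TamagawaFiniteIndexProofs
import HarnessLib

/-!
# Kato's (14.9.3) at finite level, part 28: the Tamagawa lower bound in PRODUCT form —
# `p^{v_p(Tam E)} ≤ (∏_{v ∈ P} p^{v_p(c_v)}) · ∏_{v ∈ T ∖ P} #H¹_ur(K_v, E[p^∞])` for `T ⊇` bad places, `P ⊇` places above `p`
# (route `KatoDescentPotSupersingular` / `…Tame…`, crux M = stmt-BirchSwinnertonDyer-19196; route-free helper)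

Seat `bsd-potss-rkm` g18 (prover; cell `bsd-potss`), item stmt-BirchSwinnertonDyer-19196 (`--supports … --as helper`; closes
nothing).  HONEST FRAMING: BSD is not proved by any of this; nothing is booked; theorems only (no definition, no named fact).

The input `Tam_{≠p}^{(p)}(E) ≤ ∏_{ℓ ≠ p} #H¹_ur(ℚ_ℓ, E[p^∞])` of crux M's ledger (memo `HOME/rkm/FINDING-19196-rkm-g18.md`, step (ii)) in the
tree's currency: `Tam(E) = ∏ᶠ_v c_v` (`WeierstrassCurve.tamagawaProduct`) is the finite product over any finite `T` containing the bad places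
(`c_v = 1` at good `v`, `localTamagawaNumber_eq_one_of_hasGoodReductionAt_holds`), `p^{v_p(∏ c_v)} = ∏ p^{v_p(c_v)}` (`c_v ≠ 0`,
`localTamagawaNumber_baseChange_ne_zero`), and each factor off `P` is `≤ #H¹_ur(K_v, E[p^∞])` (part 27, given a cyclotomic `ℤ_p`-extension
of `K`; unconditional over `ℚ`).

* `tamagawaProduct_eq_prod_of_good_outside` — `Tam(E) = ∏_{v ∈ T} c_v` for every finite `T` outside which `E` has good reduction;
* `pow_padicValNat_prod_eq_prod_pow` — `p^{v_p(∏ a_i)} = ∏ p^{v_p(a_i)}` for non-zero naturals;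
* **`pow_padicValNat_tamagawaProduct_le`** — `p^{v_p(Tam E)} ≤ (∏_{v∈P} p^{v_p(c_v)}) · ∏_{v ∈ T ∖ P} #H¹_ur(K_v, E[p^∞])` (`P ⊆ T`, `P ⊇ {v ∣ p}`);
* `pow_padicValNat_tamagawaProduct_le_rat` — over `ℚ` with `P = {v_p}`: `p^{v_p(Tam E)} ≤ p^{v_p(c_p)} · ∏_{ℓ ∈ T ∖ {v_p}} #H¹_ur(ℚ_ℓ, E[p^∞])`.

References: R. Greenberg, LNM 1716 (1999) §3 Lemma 3.3, §4 proof of Thm. 4.1 [GreenbergLNM1716]; K. Kato, Astérisque 295 §14.8, Prop. 14.16 (2)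
[Kato2004Asterisque]; J. H. Silverman, *AEC* VII.2 (remark after Prop. 2.1), Cor. VII.6.2 [SilvermanAEC2009].
-/

-- the summit and its single problem are both named `BirchSwinnertonDyer` (registry layout D-0017)
set_option linter.dupNamespace false
set_option autoImplicit false

noncomputable section

open scoped Classical NumberField
open Function Field NumberField IsDedekindDomain WeierstrassCurve
open Literature.NumberTheory.EllipticCurves Literature.NumberTheory.GaloisRepresentations
  Literature.NumberTheory.GaloisRepresentations.DiscreteGaloisModule Literature.NumberTheory.GaloisCohomology
open Literature.NumberTheory.EllipticCurves.Kato2004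
open Summit.BirchSwinnertonDyer.Rank1Residual.X11b.LocBridge

namespace Summit.BirchSwinnertonDyer.BirchSwinnertonDyer.Theorems.KatoFiniteLevelCount

/-! ## §1 Arithmetic helper -/

/-- `p^{v_p(∏ a_i)} = ∏ p^{v_p(a_i)}` over a finset, for a prime `p` and non-zero naturals `a_i`. [folklore] -/
theorem pow_padicValNat_prod_eq_prod_pow {ι : Type*} (p : ℕ) [Fact p.Prime] (s : Finset ι) (a : ι → ℕ)
    (ha : ∀ i ∈ s, a i ≠ 0) : p ^ padicValNat p (∏ i ∈ s, a i) = ∏ i ∈ s, p ^ padicValNat p (a i) := by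
  induction s using Finset.induction_on with
  | empty => simp
  | insert i s hi ih =>
    rw [Finset.prod_insert hi, Finset.prod_insert hi,
      padicValNat.mul (ha i (Finset.mem_insert_self i s))
        (Finset.prod_ne_zero_iff.mpr fun j hj => ha j (Finset.mem_insert_of_mem hj)),
      pow_add, ih fun j hj => ha j (Finset.mem_insert_of_mem hj)]

/-! ## §2 The Tamagawa product as a finite product and its `p`-part -/

section Product

variable {K : Type} [Field K] [NumberField K] (W : WeierstrassCurve K) [W.IsElliptic] (p : ℕ) [Fact p.Prime]

omit [W.IsElliptic] in
/-- **`Tam(E) = ∏_{v ∈ T} c_v`** for every finite set `T` of finite places outside which `E` has good reduction (`c_v = 1` at good `v`).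
[cite: SilvermanAEC2009, VII.2 (remark after Prop. 2.1) and Cor. VII.6.2] -/
theorem tamagawaProduct_eq_prod_of_good_outside (T : Finset (HeightOneSpectrum (𝓞 K)))
    (hT : ∀ v : HeightOneSpectrum (𝓞 K), v ∉ T → W.HasGoodReductionAt v) :
    W.tamagawaProduct = ∏ v ∈ T, (W.baseChange (v.adicCompletion K)).localTamagawaNumber (v.adicCompletionIntegers K) := by
  unfold WeierstrassCurve.tamagawaProduct
  refine finprod_eq_prod_of_mulSupport_subset _ fun v hv ↦ ?_
  rw [Finset.mem_coe]
  by_contra hvT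
  exact hv (W.localTamagawaNumber_eq_one_of_hasGoodReductionAt_holds v (hT v hvT))

/-- **The Tamagawa lower bound in product form.**  For `E/K` elliptic, a prime `p`, a cyclotomic `ℤ_p`-extension `κ` of `K`, finite sets
of finite places `P ⊆ T` with good reduction outside `T` and every place above `p` inside `P`:
**`p^{v_p(Tam E)} ≤ (∏_{v ∈ P} p^{v_p(c_v)}) · ∏_{v ∈ T ∖ P} #H¹_ur(K_v, E[p^∞])`** (part 27 factorwise off `P`).
[cite: GreenbergLNM1716, §3 Lemma 3.3 (p. 87) and §4 proof of Thm. 4.1 (pp. 74–75)] [cite: Kato2004Asterisque, §14.8 (p. 238)] -/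
theorem pow_padicValNat_tamagawaProduct_le (κ : ZpExtension K p) (hκ : κ.IsCyclotomic)
    (P T : Finset (HeightOneSpectrum (𝓞 K))) (hPT : P ⊆ T)
    (hT : ∀ v : HeightOneSpectrum (𝓞 K), v ∉ T → W.HasGoodReductionAt v)
    (hP : ∀ v : HeightOneSpectrum (𝓞 K), (p : 𝓞 K) ∈ v.asIdeal → v ∈ P) :
    p ^ padicValNat p W.tamagawaProduct ≤
      (∏ v ∈ P, p ^ padicValNat p ((W.baseChange (v.adicCompletion K)).localTamagawaNumber (v.adicCompletionIntegers K))) *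
        ∏ v ∈ T \ P, Nat.card (unramifiedSubgroup (GaloisRep.toLocal v (primaryGaloisModule W p)) 1) := by
  rw [tamagawaProduct_eq_prod_of_good_outside W T hT,
    pow_padicValNat_prod_eq_prod_pow p T _ (fun v _ => W.localTamagawaNumber_baseChange_ne_zero v),
    ← Finset.prod_sdiff hPT, mul_comm]
  refine Nat.mul_le_mul le_rfl (Finset.prod_le_prod' fun v hv => ?_)
  have hpv : (p : 𝓞 K) ∉ v.asIdeal := fun h => (Finset.mem_sdiff.mp hv).2 (hP v h)
  exact pow_padicValNat_localTamagawaNumber_le_natCard_unramifiedSubgroup_primary W p v κ hκ hpv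

end Product

/-! ## §3 Over `ℚ` -/

section Rat

variable (W : WeierstrassCurve ℚ) [W.IsElliptic] (p : ℕ) [Fact p.Prime]

/-- **Over `ℚ`: `p^{v_p(Tam E)} ≤ p^{v_p(c_p)} · ∏_{ℓ ∈ T ∖ {v_p}} #H¹_ur(ℚ_ℓ, E[p^∞])`** for every finite `T ∋ v_p` outside which `E` has good
reduction — the Tamagawa input (ii)/(δ) of crux M's ledger (`Tam_{≠p}^{(p)} ≤ ∏_{ℓ≠p} #H¹_ur`), unconditionally.
[cite: GreenbergLNM1716, §3 Lemma 3.3 (p. 87) and §4 proof of Thm. 4.1 (pp. 74–75)] [cite: Kato2004Asterisque, §14.8 (p. 238), Prop. 14.16 (2)] -/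
theorem pow_padicValNat_tamagawaProduct_le_rat (T : Finset (HeightOneSpectrum (𝓞 ℚ))) (hpT : primePlace p ∈ T)
    (hT : ∀ v : HeightOneSpectrum (𝓞 ℚ), v ∉ T → W.HasGoodReductionAt v) :
    p ^ padicValNat p W.tamagawaProduct ≤
      p ^ padicValNat p ((W.baseChange ((primePlace p).adicCompletion ℚ)).localTamagawaNumber
          ((primePlace p).adicCompletionIntegers ℚ)) *
        ∏ v ∈ T \ {primePlace p}, Nat.card (unramifiedSubgroup (GaloisRep.toLocal v (primaryGaloisModule W p)) 1) := by
  have h := pow_padicValNat_tamagawaProduct_le W p (CyclotomicZp.zpExtension p) (CyclotomicZp.isCyclotomic_zpExtension p)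
    {primePlace p} T (Finset.singleton_subset_iff.mpr hpT) hT
    (fun v hv => Finset.mem_singleton.mpr (eq_primePlace_of_natCast_mem p hv))
  rwa [Finset.prod_singleton] at h

end Rat

end Summit.BirchSwinnertonDyer.BirchSwinnertonDyer.Theorems.KatoFiniteLevelCount

end
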